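import Mathlib
import Literature.Analysis.Complex.SimilarityPrinciple
import Literature.Analysis.Complex.DbarAlongCalculus
import Literature.Analysis.Convolution.ScaledMollifier
import HarnessLib

/-!
# The similarity principle for `C¹` functions (comparison form)

The comparison form of the Carleman–Bers–Vekua similarity principle of
`Literature/Analysis/Complex/SimilarityPrinciple.lean` (`similarity_comparison`: a smooth `w` with
`‖∂̄ w‖ ≤ M ‖w‖` on `‖z‖ ≤ ρ` is comparable, `e^{-S} ‖w‖ ≤ ‖H‖ ≤ e^{S} ‖w‖`, to a holomorphic
`H` on every smaller disc, with equal winding numbers along zero-free circles) is extended from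
`C^∞` to `C¹` functions `c : ℂ → ℂ` (I. N. Vekua, *Generalized analytic functions* (1962), Ch. III
§4; L. Bers (1953); C. Wendl, *Lectures on Contact 3-Manifolds, Holomorphic Curves and
Intersection Theory* (2020), App. B, Thm. B.20 — there for `W^{1,p}` sections, which contains the
`C¹` case):

* `similarity_comparison_C1` — the comparison statement for `c ∈ C¹`;
* `similarity_wind_pos_C1`, `similarity_wind_nonneg_C1`, `similarity_isolated_zero_C1` — zeros are
  isolated (unless `c ≡ 0` on the disc) and of positive index;
* `wind_circleLoop_ge_of_norm_le_pow` (holomorphic), `similarity_wind_ge_of_norm_le_pow_C1` — if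
  moreover `‖c z‖ ≤ K ‖z‖ ^ m` on the disc, the index of `c` along small circles about `0` is at
  least `m`
  (the holomorphic comparison function is `O(|z|^m)`, so `H = z^m G` by the removable singularity
  theorem, and `G` has non-negative index by the argument principle).

This is the regularity in which the principle is needed for the normal components of branch
differences of `J`-holomorphic curves at critical points (Wendl 2020, Thm. B.23, where the
reparametrised curves are only `C¹` at the critical point; McDuff 1991, Lemma 2.4).

Proof: NO new analysis at the `C¹` level. The smooth `δ`-regularisation device is run with an
ADDITIVE DEFECT: if `‖∂̄ w‖ ≤ M ‖w‖ + ε` on the disc (`w` smooth), the regularised coefficient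
`a = χ ∂̄w · w̄ / (|w|² + t²)` has `‖a‖ ≤ M + ε / (2t)` and `‖χ ∂̄ w - a w‖ ≤ M t / 2 + ε`
(`Similarity.norm_coeff_le_of_defect`, `Similarity.norm_sub_coeff_mul_le_of_defect`), so for
`ε ≤ t` the approximation package `Similarity.exists_approx_defect` produces a smooth potential `s`,
`‖s‖ ≤ S = 4ρ(M + 1)`, and `H_t` holomorphic with `‖e^{-s} w - H_t‖ ≤ C e^S (M/2 + 1) t`. A `C¹`
function `c` with `‖∂̄ c‖ ≤ M ‖c‖` is approximated in `C¹` on the disc by smooth mollifications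
`w` (`Similarity.exists_smooth_approx_C1`, the tree's `Literature.Analysis.Convolution.mollify`,
`D(ρ_ε ⋆ c) = ρ_ε ⋆ Dc`), which satisfy `‖∂̄ w‖ ≤ M ‖w‖ + ε` with `ε → 0`; along `t = 1/(n+1)`
this gives holomorphic `H_n` with `‖e^{-s_n} c - H_n‖ → 0` uniformly on `‖z‖ ≤ ρ'`, and the Montel
and Rouché steps of the smooth proof (`Literature.Analysis.Complex.Montel`,
`Similarity.norm_le_of_tendsto`, `Similarity.wind_eq_of_approx`) apply verbatim.

Everything is proved; no named facts.

## References

* I. N. Vekua, *Generalized analytic functions* (1962), Ch. III, §4 (similarity principle).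
* C. Wendl, *Lectures on Contact 3-Manifolds, Holomorphic Curves and Intersection Theory* (2020),
  App. B, Thm B.20, Cor B.21. [Wendl2020]
* D. McDuff, D. Salamon, *J-holomorphic curves and symplectic topology*, 2nd ed. (2012), §2.3.
  [McDuffSalamon2012]
-/

noncomputable section

open scoped ContDiff ComplexConjugate Topology
open Filter Set Metric Complex
open Literature.Topology.PlaneTopology

namespace Literature.Analysis.Complex

namespace Similarity

/-! ### The regularised coefficient with an additive defect -/

/-- AM–GM in the form `g ≤ (2√δ)⁻¹ (g² + δ)`. [folklore] -/
theorem le_inv_two_sqrt_mul (g δ : ℝ) (hδ : 0 < δ) :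
    g ≤ (2 * Real.sqrt δ)⁻¹ * (g ^ 2 + δ) := by
  have hs : Real.sqrt δ ^ 2 = δ := Real.sq_sqrt hδ.le
  have hspos : 0 < Real.sqrt δ := Real.sqrt_pos.2 hδ
  rw [le_inv_mul_iff₀ (by positivity)]
  nlinarith [sq_nonneg (g - Real.sqrt δ)]

/-- The uniform bound `‖a_δ‖ ≤ M + ε (2√δ)⁻¹` for the regularised coefficient under the defective
inequality `‖r‖ ≤ M ‖G‖ + ε`. [folklore] -/
theorem norm_coeff_le_of_defect (G r : ℂ → ℂ) (M ε δ : ℝ) (hM : 0 ≤ M) (hε : 0 ≤ ε) (hδ : 0 < δ)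
    (hbound : ∀ η, ‖r η‖ ≤ M * ‖G η‖ + ε) (η : ℂ) :
    ‖r η * conj (G η) / (((‖G η‖ ^ 2 + δ : ℝ)) : ℂ)‖ ≤ M + ε * (2 * Real.sqrt δ)⁻¹ := by
  rw [norm_coeff G r δ hδ η, div_le_iff₀ (denom_pos (G η) hδ)]
  have hg : 0 ≤ ‖G η‖ := norm_nonneg _
  calc ‖r η‖ * ‖G η‖ ≤ (M * ‖G η‖ + ε) * ‖G η‖ := mul_le_mul_of_nonneg_right (hbound η) hg
    _ = M * (‖G η‖ * ‖G η‖) + ε * ‖G η‖ := by ring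
    _ ≤ M * (‖G η‖ ^ 2 + δ) + ε * ((2 * Real.sqrt δ)⁻¹ * (‖G η‖ ^ 2 + δ)) :=
        add_le_add (mul_le_mul_of_nonneg_left (by nlinarith) hM)
          (mul_le_mul_of_nonneg_left (le_inv_two_sqrt_mul _ δ hδ) hε)
    _ = (M + ε * (2 * Real.sqrt δ)⁻¹) * (‖G η‖ ^ 2 + δ) := by ring

/-- The approximation bound `‖r - a_δ G‖ ≤ M √δ / 2 + ε` under the defective inequality
`‖r‖ ≤ M ‖G‖ + ε`. [folklore] -/
theorem norm_sub_coeff_mul_le_of_defect (G r : ℂ → ℂ) (M ε δ : ℝ) (hM : 0 ≤ M) (hε : 0 ≤ ε)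
    (hδ : 0 < δ) (hbound : ∀ η, ‖r η‖ ≤ M * ‖G η‖ + ε) (η : ℂ) :
    ‖r η - r η * conj (G η) / (((‖G η‖ ^ 2 + δ : ℝ)) : ℂ) * G η‖ ≤
      M * Real.sqrt δ / 2 + ε := by
  have hNpos := denom_pos (G η) hδ
  have hg : 0 ≤ ‖G η‖ := norm_nonneg _
  rw [sub_coeff_mul G r δ hδ η, norm_div, norm_mul, Complex.norm_of_nonneg hδ.le,
    Complex.norm_of_nonneg hNpos.le, div_le_iff₀ hNpos]
  calc ‖r η‖ * δ ≤ (M * ‖G η‖ + ε) * δ := mul_le_mul_of_nonneg_right (hbound η) hδ.le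
    _ = M * (‖G η‖ * δ) + ε * δ := by ring
    _ ≤ M * (Real.sqrt δ / 2 * (‖G η‖ ^ 2 + δ)) + ε * (‖G η‖ ^ 2 + δ) :=
        add_le_add (mul_le_mul_of_nonneg_left (mul_le_sqrt_half_mul ‖G η‖ δ hg hδ) hM)
          (mul_le_mul_of_nonneg_left (by nlinarith) hε)
    _ = (M * Real.sqrt δ / 2 + ε) * (‖G η‖ ^ 2 + δ) := by ring

/-! ### The approximation package with defect -/

/-- **The approximation package with an additive defect.** As `Similarity.exists_approx`, but
under `‖r‖ ≤ M ‖w‖ + ε` on `‖z‖ ≤ ρ` with `0 ≤ ε ≤ t`: with `δ = t²` the regularised coefficient is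
bounded by `M + 1`, its potential `s` by `S ≥ 4ρ(M + 1)`, and `h = e^{-s} w` has
`‖∂̄ h‖ ≤ e^S (M/2 + 1) t` on `‖z‖ ≤ ρ''`, hence is `C e^S (M/2 + 1) t`-close on `‖z‖ ≤ ρ'` to a
function holomorphic on `‖z‖ < ρ'`. [folklore] -/
theorem exists_approx_defect {w r χ : ℂ → ℂ} {M ε ρ ρ' ρ'' C S : ℝ} (hM : 0 ≤ M) (hε : 0 ≤ ε)
    (hρ : 0 ≤ ρ) (hρ'' : ρ'' ≤ ρ) (hS : 2 * (ρ + ρ) * (M + 1) ≤ S)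
    (hw : ContDiff ℝ ∞ w) (hr : ContDiff ℝ ∞ r) (hdbar : ∀ η, dbarAlong 1 w η = r η)
    (hbound : ∀ η : ℂ, ‖η‖ ≤ ρ → ‖r η‖ ≤ M * ‖w η‖ + ε)
    (hχ : ContDiff ℝ ∞ χ) (hχ1 : ∀ z : ℂ, ‖z‖ ≤ ρ'' → χ z = 1)
    (hχ0 : ∀ z : ℂ, χ z ≠ 0 → ‖z‖ < ρ) (hχle : ∀ z : ℂ, ‖χ z‖ ≤ 1)
    (hC : ∀ (k : ℂ → ℂ) (ε : ℝ), ContDiff ℝ ∞ k → 0 ≤ ε →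
      (∀ η : ℂ, ‖η‖ ≤ ρ'' → ‖dbarAlong 1 k η‖ ≤ ε) →
      ∃ H : ℂ → ℂ, DifferentiableOn ℂ H (ball 0 ρ') ∧ ∀ η : ℂ, ‖η‖ ≤ ρ' → ‖k η - H η‖ ≤ C * ε)
    {t : ℝ} (ht : 0 < t) (hεt : ε ≤ t) :
    ∃ s H : ℂ → ℂ, ContDiff ℝ ∞ s ∧ (∀ z : ℂ, ‖z‖ ≤ ρ → ‖s z‖ ≤ S) ∧
      DifferentiableOn ℂ H (ball 0 ρ') ∧
      ∀ z : ℂ, ‖z‖ ≤ ρ' →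
        ‖Complex.exp (-s z) * w z - H z‖ ≤ C * (Real.exp S * ((M / 2 + 1) * t)) := by
  -- the localised coefficient `r̃ = χ r`
  set r' : ℂ → ℂ := fun η => χ η * r η with hr'_def
  have hr' : ContDiff ℝ ∞ r' := hχ.mul hr
  have hsupp : ∀ η : ℂ, ρ ≤ ‖η‖ → r' η = 0 := fun η hη => by
    have hχη : χ η = 0 := by
      by_contra h
      exact (not_lt.2 hη) (hχ0 η h)
    simp [hr'_def, hχη]
  have hbound' : ∀ η, ‖r' η‖ ≤ M * ‖w η‖ + ε := fun η => by
    by_cases hη : ‖η‖ ≤ ρ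
    · calc ‖r' η‖ = ‖χ η‖ * ‖r η‖ := norm_mul _ _
        _ ≤ 1 * (M * ‖w η‖ + ε) :=
            mul_le_mul (hχle η) (hbound η hη) (norm_nonneg _) zero_le_one
        _ = M * ‖w η‖ + ε := one_mul _
    · rw [hsupp η (not_le.1 hη).le, norm_zero]
      positivity
  -- the regularised coefficient with `δ = t²`
  set a : ℂ → ℂ := fun η => r' η * conj (w η) / (((‖w η‖ ^ 2 + t ^ 2 : ℝ)) : ℂ)
    with ha_def
  have hδ : 0 < t ^ 2 := by positivity
  have ha : ContDiff ℝ ∞ a := contDiff_coeff w r' (t ^ 2) hδ hw hr'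
  have hac : HasCompactSupport a := hasCompactSupport_coeff w r' ρ (t ^ 2) hsupp
  have hsq : Real.sqrt (t ^ 2) = t := Real.sqrt_sq ht.le
  have haM : ∀ η, ‖a η‖ ≤ M + 1 := fun η => by
    have h := norm_coeff_le_of_defect w r' M ε (t ^ 2) hM hε hδ hbound' η
    rw [hsq] at h
    have h2 : ε * (2 * t)⁻¹ ≤ 1 := by
      rw [mul_inv_le_iff₀ (by positivity)]
      linarith
    exact h.trans (by linarith)
  have ha0 : ∀ η : ℂ, ρ ≤ ‖η‖ → a η = 0 := fun η hη => by simp [ha_def, hsupp η hη]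
  have har : ∀ η, ‖r' η - a η * w η‖ ≤ (M / 2 + 1) * t := fun η => by
    have h := norm_sub_coeff_mul_le_of_defect w r' M ε (t ^ 2) hM hε hδ hbound' η
    rw [hsq] at h
    calc ‖r' η - a η * w η‖ ≤ M * t / 2 + ε := h
      _ ≤ (M / 2 + 1) * t := by nlinarith
  -- the potential
  obtain ⟨s, hs, hds, hsS⟩ :=
    exists_potential (ρ := ρ) hρ hρ (by positivity : (0 : ℝ) ≤ M + 1) ha hac haM ha0
  have hsS' : ∀ z : ℂ, ‖z‖ ≤ ρ → ‖s z‖ ≤ S := fun z hz => (hsS z hz).trans hS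
  have hsd : Differentiable ℝ s := hs.differentiable (by simp)
  have hwd : Differentiable ℝ w := hw.differentiable (by simp)
  -- the modified function `h = e^{-s} w`
  set h : ℂ → ℂ := fun z => Complex.exp (-s z) * w z with hh_def
  have hh : ContDiff ℝ ∞ h := hs.neg.cexp.mul hw
  have hdh : ∀ z : ℂ, ‖z‖ ≤ ρ'' → ‖dbarAlong 1 h z‖ ≤ Real.exp S * ((M / 2 + 1) * t) := by
    intro z hz
    have hrz : r z = r' z := by simp [hr'_def, hχ1 z hz]
    rw [hh_def, dbarAlong_one_exp_neg_mul (hsd z) (hwd z), hdbar z, hds z, norm_mul, hrz]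
    exact mul_le_mul (norm_exp_neg_le (hsS' z (by linarith))) (har z) (norm_nonneg _)
      (Real.exp_pos S).le
  obtain ⟨H, hH, hHh⟩ := hC h (Real.exp S * ((M / 2 + 1) * t)) hh (by positivity) hdh
  exact ⟨s, H, hs, hsS', hH, hHh⟩

/-! ### Smooth `C¹`-approximation by mollification -/

/-- **Smooth approximation in `C¹`.** A compactly supported `C¹` function `c : ℂ → ℂ` is, for
every `η > 0`, uniformly `η`-close together with its partial derivatives `∂ₓ`, `∂_y` to a smooth
function (its mollification `ρ_ε ⋆ c`, whose derivative is `ρ_ε ⋆ Dc`; uniform continuity of `c`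
and `Dc`). [folklore] -/
theorem exists_smooth_approx_C1 {c : ℂ → ℂ} (hc : ContDiff ℝ 1 c) (hcs : HasCompactSupport c)
    {η : ℝ} (hη : 0 < η) :
    ∃ w : ℂ → ℂ, ContDiff ℝ ∞ w ∧ (∀ x, ‖w x - c x‖ ≤ η) ∧
      (∀ x, ‖fderiv ℝ w x 1 - fderiv ℝ c x 1‖ ≤ η) ∧
      (∀ x, ‖fderiv ℝ w x I - fderiv ℝ c x I‖ ≤ η) := by
  have hcc : Continuous c := hc.continuous
  have hD : Continuous (fderiv ℝ c) := hc.continuous_fderiv one_ne_zero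
  have hg1 : Continuous fun y => fderiv ℝ c y 1 := hD.clm_apply continuous_const
  have hgI : Continuous fun y => fderiv ℝ c y I := hD.clm_apply continuous_const
  have hs1 : HasCompactSupport fun y => fderiv ℝ c y (1 : ℂ) := hcs.fderiv_apply (𝕜 := ℝ) 1
  have hsI : HasCompactSupport fun y => fderiv ℝ c y I := hcs.fderiv_apply (𝕜 := ℝ) I
  obtain ⟨δ₀, hδ₀, h0⟩ :=
    Metric.uniformContinuous_iff.1 (hcs.uniformContinuous_of_continuous hcc) η hη
  obtain ⟨δ₁, hδ₁, h1⟩ :=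
    Metric.uniformContinuous_iff.1 (hs1.uniformContinuous_of_continuous hg1) η hη
  obtain ⟨δ₂, hδ₂, h2⟩ :=
    Metric.uniformContinuous_iff.1 (hsI.uniformContinuous_of_continuous hgI) η hη
  set ε : ℝ := min δ₀ (min δ₁ δ₂) / 4 with hε_def
  have hmin : 0 < min δ₀ (min δ₁ δ₂) := lt_min hδ₀ (lt_min hδ₁ hδ₂)
  have hε : 0 < ε := by positivity
  have hε₀ : 2 * ε < δ₀ := by
    have := min_le_left δ₀ (min δ₁ δ₂)
    rw [hε_def]; linarith
  have hε₁ : 2 * ε < δ₁ := by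
    have := (min_le_right δ₀ (min δ₁ δ₂)).trans (min_le_left δ₁ δ₂)
    rw [hε_def]; linarith
  have hε₂ : 2 * ε < δ₂ := by
    have := (min_le_right δ₀ (min δ₁ δ₂)).trans (min_le_right δ₁ δ₂)
    rw [hε_def]; linarith
  refine ⟨Convolution.mollify ε c, Convolution.contDiff_mollify ε hcc.locallyIntegrable (n := ⊤),
    fun x => ?_, fun x => ?_, fun x => ?_⟩
  · rw [← dist_eq_norm]
    exact Convolution.dist_mollify_le hε hcc.aestronglyMeasurable fun y hy =>
      (h0 (lt_trans (mem_ball.1 hy) hε₀)).le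
  · rw [Convolution.fderiv_mollify_apply_eq_mollify ε hc hcs x 1, ← dist_eq_norm]
    exact Convolution.dist_mollify_le hε hg1.aestronglyMeasurable fun y hy =>
      (h1 (lt_trans (mem_ball.1 hy) hε₁)).le
  · rw [Convolution.fderiv_mollify_apply_eq_mollify ε hc hcs x I, ← dist_eq_norm]
    exact Convolution.dist_mollify_le hε hgI.aestronglyMeasurable fun y hy =>
      (h2 (lt_trans (mem_ball.1 hy) hε₂)).le

/-- The difference of two `∂̄`'s is controlled by the differences of the partial derivatives:
`‖∂̄ w - ∂̄ c‖ ≤ (‖∂ₓ w - ∂ₓ c‖ + ‖∂_y w - ∂_y c‖) / 2`. [folklore] -/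
theorem norm_dbarAlong_one_sub_le (w c : ℂ → ℂ) (z : ℂ) :
    ‖dbarAlong 1 w z - dbarAlong 1 c z‖ ≤
      (‖fderiv ℝ w z 1 - fderiv ℝ c z 1‖ + ‖fderiv ℝ w z I - fderiv ℝ c z I‖) / 2 := by
  rw [dbarAlong_one, dbarAlong_one, ← smul_sub, norm_smul, norm_inv, Complex.norm_two]
  have h : fderiv ℝ w z 1 + I • fderiv ℝ w z I - (fderiv ℝ c z 1 + I • fderiv ℝ c z I) =
      (fderiv ℝ w z 1 - fderiv ℝ c z 1) + I • (fderiv ℝ w z I - fderiv ℝ c z I) := by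
    rw [smul_sub]; abel
  rw [h]
  have h2 : ‖(fderiv ℝ w z 1 - fderiv ℝ c z 1) + I • (fderiv ℝ w z I - fderiv ℝ c z I)‖ ≤
      ‖fderiv ℝ w z 1 - fderiv ℝ c z 1‖ + ‖fderiv ℝ w z I - fderiv ℝ c z I‖ := by
    refine (norm_add_le _ _).trans ?_
    rw [norm_smul, Complex.norm_I, one_mul]
  rw [inv_mul_eq_div]
  exact div_le_div_of_nonneg_right h2 zero_le_two

/-- `∂̄ w` is smooth for smooth `w`, with the defective inequality transported from a `C¹`
function `c₀` that `w` approximates in `C¹`: if `‖∂̄ c₀‖ ≤ M ‖c₀‖` at `z` and `w`, `∂ₓ w`, `∂_y w`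
are `η`-close to `c₀`, `∂ₓ c₀`, `∂_y c₀`, then `‖∂̄ w z‖ ≤ M ‖w z‖ + (M + 1) η`. [folklore] -/
theorem smooth_dbar_defect {w c₀ : ℂ → ℂ} {M η : ℝ} {z : ℂ} (hM : 0 ≤ M)
    (hw0 : ‖w z - c₀ z‖ ≤ η) (hw1 : ‖fderiv ℝ w z 1 - fderiv ℝ c₀ z 1‖ ≤ η)
    (hwI : ‖fderiv ℝ w z I - fderiv ℝ c₀ z I‖ ≤ η)
    (hc₀ : ‖dbarAlong 1 c₀ z‖ ≤ M * ‖c₀ z‖) :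
    ‖dbarAlong 1 w z‖ ≤ M * ‖w z‖ + (M + 1) * η := by
  have e1 : ‖dbarAlong 1 w z - dbarAlong 1 c₀ z‖ ≤ η := by
    have h := norm_dbarAlong_one_sub_le w c₀ z
    linarith
  have e3 : ‖c₀ z‖ ≤ ‖w z‖ + η := by
    have h' := norm_sub_norm_le (c₀ z) (w z)
    rw [norm_sub_rev] at hw0
    linarith
  have e4 := norm_le_insert' (dbarAlong 1 w z) (dbarAlong 1 c₀ z)
  calc ‖dbarAlong 1 w z‖ ≤ ‖dbarAlong 1 c₀ z‖ + η := by linarith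
    _ ≤ M * (‖w z‖ + η) + η := by nlinarith
    _ = M * ‖w z‖ + (M + 1) * η := by ring

end Similarity

open Similarity

/-! ### The comparison theorem for `C¹` functions -/

/-- **Similarity principle for `C¹` functions, comparison form** (Carleman–Bers–Vekua; Vekua
1962, Ch. III §4; Wendl 2020, Thm B.20). Let `c : ℂ → ℂ` be `C¹` with `‖∂̄ c‖ ≤ M ‖c‖` on
`‖z‖ ≤ ρ`, and let `0 < ρ' < ρ`. Then there are `S : ℝ` and `H` holomorphic on `‖z‖ < ρ'` with
`e^{-S} ‖c z‖ ≤ ‖H z‖ ≤ e^{S} ‖c z‖` for `‖z‖ < ρ'`, and `wind (c ∘ γ) = wind (H ∘ γ)` along every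
circle `γ : ‖z - z₀‖ = ε` with `‖z₀‖ + ε < ρ'` on which `c` has no zero.
[cite: Wendl2020, App. B Thm B.20 and Cor B.21 (similarity principle)] -/
theorem similarity_comparison_C1 (c : ℂ → ℂ) (M ρ ρ' : ℝ) (hρ' : 0 < ρ') (hρ : ρ' < ρ)
    (hc : ContDiff ℝ 1 c)
    (hbound : ∀ η : ℂ, ‖η‖ ≤ ρ → ‖dbarAlong 1 c η‖ ≤ M * ‖c η‖) :
    ∃ (S : ℝ) (H : ℂ → ℂ), DifferentiableOn ℂ H (ball 0 ρ') ∧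
      (∀ z : ℂ, ‖z‖ < ρ' → Real.exp (-S) * ‖c z‖ ≤ ‖H z‖ ∧ ‖H z‖ ≤ Real.exp S * ‖c z‖) ∧
      ∀ (z₀ : ℂ) (ε : ℝ), 0 < ε → ‖z₀‖ + ε < ρ' → (∀ z : ℂ, ‖z - z₀‖ = ε → c z ≠ 0) →
        wind (fun t => c (circleLoop z₀ ε t)) = wind (fun t => H (circleLoop z₀ ε t)) := by
  -- the degenerate case `c ≡ 0` on `‖z‖ ≤ ρ`: take `H = 0`
  by_cases hne : ∃ z : ℂ, ‖z‖ ≤ ρ ∧ c z ≠ 0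
  swap
  · push Not at hne
    refine ⟨0, 0, differentiableOn_const 0, fun z hz => ?_, fun z₀ ε hε hz₀ε hw0 => ?_⟩
    · simp [hne z (by linarith)]
    · exact absurd (hne (z₀ + ε) (by
        have := norm_add_le z₀ (ε : ℂ)
        rw [Complex.norm_real, Real.norm_of_nonneg hε.le] at this
        linarith)) (hw0 (z₀ + ε) (by simp [hε.le]))
  obtain ⟨z₁, hz₁, h1⟩ := hne
  have hM : 0 ≤ M :=
    nonneg_of_mul_nonneg_left ((norm_nonneg _).trans (hbound z₁ hz₁)) (norm_pos_iff.2 h1)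
  have hρ0 : 0 ≤ ρ := by linarith
  -- compactly supported modification `c₀ = χ₀ c`, equal to `c` on `‖z‖ ≤ ρ + 1`
  obtain ⟨χ₀, hχ₀, hχ₀c, hχ₀1, -, -⟩ :=
    Similarity.exists_cutoff (ρm := ρ + 1) (ρ := ρ + 2) (by linarith) (by linarith)
  set c₀ : ℂ → ℂ := fun z => χ₀ z * c z with hc₀_def
  have hc₀ : ContDiff ℝ 1 c₀ := (hχ₀.of_le (by exact_mod_cast le_top)).mul hc
  have hc₀s : HasCompactSupport c₀ := hχ₀c.mul_right
  have hc₀eq : ∀ z : ℂ, ‖z‖ ≤ ρ + 1 → c₀ z = c z := fun z hz => by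
    simp [hc₀_def, hχ₀1 z hz]
  have hdbar₀ : ∀ z : ℂ, ‖z‖ ≤ ρ → dbarAlong 1 c₀ z = dbarAlong 1 c z := by
    intro z hz
    refine dbarAlong_congr_of_eventuallyEq ?_ 1
    filter_upwards [Metric.ball_mem_nhds z one_pos] with y hy
    refine hc₀eq y ?_
    have h1 : ‖y - z‖ < 1 := by rwa [mem_ball, dist_eq_norm] at hy
    have h2 := norm_le_insert' y z
    linarith
  -- the approximation scheme
  obtain ⟨C, hC0, hC⟩ := exists_holomorphic_approx_of_dbar_le ρ' ((ρ' + ρ) / 2) hρ' (by linarith)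
  obtain ⟨χ, hχ, -, hχ1, hχ0, hχle⟩ :=
    Similarity.exists_cutoff (ρm := (ρ' + ρ) / 2) (ρ := ρ) (by linarith) (by linarith)
  set S : ℝ := 2 * (ρ + ρ) * (M + 1) with hS_def
  set A : ℝ := C * (Real.exp S * (M / 2 + 1)) + Real.exp S / (M + 1) with hA_def
  have hA0 : 0 ≤ A := by positivity
  have key : ∀ n : ℕ, ∃ s H : ℂ → ℂ, ContDiff ℝ ∞ s ∧ (∀ z : ℂ, ‖z‖ ≤ ρ → ‖s z‖ ≤ S) ∧
      DifferentiableOn ℂ H (ball 0 ρ') ∧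
      ∀ z : ℂ, ‖z‖ ≤ ρ' →
        ‖Complex.exp (-s z) * c z - H z‖ ≤ A * (1 / ((n : ℝ) + 1)) := by
    intro n
    set t : ℝ := 1 / ((n : ℝ) + 1) with ht_def
    have ht : 0 < t := by positivity
    set η : ℝ := t / (M + 1) with hη_def
    have hη : 0 < η := by positivity
    have hηt : (M + 1) * η = t := by
      rw [hη_def]; field_simp
    obtain ⟨w, hw, hw0, hw1, hwI⟩ := exists_smooth_approx_C1 hc₀ hc₀s hη
    -- `∂̄ w` is smooth
    have hr : ContDiff ℝ ∞ (dbarAlong 1 w) := by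
      have hD : ContDiff ℝ ∞ (fderiv ℝ w) := (contDiff_infty_iff_fderiv.1 hw).2
      have h : dbarAlong 1 w = fun z => (2 : ℂ)⁻¹ • (fderiv ℝ w z 1 + I • fderiv ℝ w z I) :=
        funext fun z => dbarAlong_one w z
      rw [h]
      have h1 : ContDiff ℝ ∞ fun z => fderiv ℝ w z 1 := hD.clm_apply contDiff_const
      have h2 : ContDiff ℝ ∞ fun z => fderiv ℝ w z I := hD.clm_apply contDiff_const
      have h3 : ContDiff ℝ ∞ fun z => I • fderiv ℝ w z I := (contDiff_const (c := I)).smul h2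
      exact (contDiff_const (c := (2 : ℂ)⁻¹)).smul (h1.add h3)
    -- the defective inequality for `w`
    have hbd : ∀ z : ℂ, ‖z‖ ≤ ρ → ‖dbarAlong 1 w z‖ ≤ M * ‖w z‖ + t := by
      intro z hz
      have e2 : ‖dbarAlong 1 c₀ z‖ ≤ M * ‖c₀ z‖ := by
        rw [hdbar₀ z hz, hc₀eq z (by linarith)]
        exact hbound z hz
      have h := smooth_dbar_defect hM (hw0 z) (hw1 z) (hwI z) e2
      rwa [hηt] at h
    obtain ⟨s, H, hs, hsS, hH, happ⟩ :=
      exists_approx_defect (ρ'' := (ρ' + ρ) / 2) hM ht.le hρ0 (by linarith) le_rfl hw hr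
        (fun _ => rfl) hbd hχ hχ1 hχ0 hχle hC ht le_rfl
    refine ⟨s, H, hs, hsS, hH, fun z hz => ?_⟩
    have h1 := happ z hz
    have h2 : ‖Complex.exp (-s z) * c z - Complex.exp (-s z) * w z‖ ≤ Real.exp S * η := by
      rw [← mul_sub, norm_mul, ← hc₀eq z (by linarith), norm_sub_rev]
      exact mul_le_mul (norm_exp_neg_le (hsS z (by linarith))) (hw0 z) (norm_nonneg _)
        (Real.exp_pos S).le
    calc ‖Complex.exp (-s z) * c z - H z‖
        ≤ ‖Complex.exp (-s z) * c z - Complex.exp (-s z) * w z‖ +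
            ‖Complex.exp (-s z) * w z - H z‖ := norm_sub_le_norm_sub_add_norm_sub _ _ _
      _ ≤ Real.exp S * η + C * (Real.exp S * ((M / 2 + 1) * t)) := add_le_add h2 h1
      _ = A * t := by rw [hA_def, hη_def]; ring
  choose s Hn hs hsS hH happ using key
  -- uniform bound for the `Hn` on the disc
  obtain ⟨W, hW⟩ := (isCompact_closedBall (0 : ℂ) ρ').exists_bound_of_continuousOn
    hc.continuous.continuousOn
  have hB : ∀ n, ∀ z ∈ ball (0 : ℂ) ρ', ‖Hn n z‖ ≤ Real.exp S * W + A := by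
    intro n z hz
    have hz' : ‖z‖ ≤ ρ' := (mem_ball_zero_iff.1 hz).le
    have h1 := happ n z hz'
    have h2 : ‖Complex.exp (-s n z) * c z‖ ≤ Real.exp S * W := by
      rw [norm_mul]
      exact mul_le_mul (norm_exp_neg_le (hsS n z (by linarith)))
        (hW z (mem_closedBall_zero_iff.2 hz')) (norm_nonneg _) (Real.exp_pos S).le
    have h3 : A * (1 / ((n : ℝ) + 1)) ≤ A := by
      have : 1 / ((n : ℝ) + 1) ≤ 1 := by
        rw [div_le_one (by positivity)]
        linarith [n.cast_nonneg (α := ℝ)]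
      nlinarith
    have h4 := norm_le_insert (Complex.exp (-s n z) * c z) (Hn n z)
    linarith
  -- Montel: a locally uniformly convergent subsequence with holomorphic limit `Hlim`
  obtain ⟨Hlim, φ, hφ, hHlim, hloc, -⟩ :=
    Complex.exists_strictMono_tendstoLocallyUniformlyOn_of_norm_le isOpen_ball hH hB
  -- the errors along the subsequence tend to `0`
  set e : ℕ → ℝ := fun k => A * (1 / ((φ k : ℝ) + 1)) with he_def
  have he : Tendsto e atTop (𝓝 0) := by
    have h1 : Tendsto (fun k => 1 / ((φ k : ℝ) + 1)) atTop (𝓝 0) :=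
      (tendsto_one_div_add_atTop_nhds_zero_nat (𝕜 := ℝ)).comp hφ.tendsto_atTop
    have h2 := h1.const_mul A
    rwa [mul_zero] at h2
  -- the two-sided comparison on `‖z‖ < ρ'`
  have hcomp : ∀ z : ℂ, ‖z‖ < ρ' →
      Real.exp (-S) * ‖c z‖ ≤ ‖Hlim z‖ ∧ ‖Hlim z‖ ≤ Real.exp S * ‖c z‖ := by
    intro z hz
    refine norm_le_of_tendsto (v := fun k => Complex.exp (-s (φ k) z) * c z)
      (hloc.tendsto_at (mem_ball_zero_iff.2 hz)) he (fun k => happ (φ k) z hz.le)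
      (fun k => ?_) (fun k => ?_)
    · rw [norm_mul]
      exact mul_le_mul_of_nonneg_right (exp_neg_le_norm_exp_neg (hsS _ z (by linarith)))
        (norm_nonneg _)
    · rw [norm_mul]
      exact mul_le_mul_of_nonneg_right (norm_exp_neg_le (hsS _ z (by linarith))) (norm_nonneg _)
  refine ⟨S, Hlim, hHlim, hcomp, fun z₀ ε hε hz₀ε hw0 => ?_⟩
  -- winding numbers along a circle on which `c` (hence `Hlim`) has no zero
  have hH0 : ∀ z : ℂ, ‖z - z₀‖ = ε → Hlim z ≠ 0 := fun z hz hH => by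
    have hzρ : ‖z‖ < ρ' := by
      have := norm_le_insert' z z₀
      linarith
    have h2 := (hcomp z hzρ).1
    rw [hH, norm_zero] at h2
    have h3 : 0 < Real.exp (-S) * ‖c z‖ := mul_pos (Real.exp_pos _) (norm_pos_iff.2 (hw0 z hz))
    linarith
  exact wind_eq_of_approx hε hz₀ε hc.continuous (fun k => (hs (φ k)).continuous) hHlim hloc
    (fun k z hz => happ (φ k) z hz) he hw0 hH0

/-! ### Consequences: positivity of the index, isolated zeros -/

/-- **Similarity principle for `C¹` functions: positivity of the index.** If `c ∈ C¹` with
`‖∂̄ c‖ ≤ M ‖c‖` on `‖z‖ ≤ ρ` vanishes at `z₀` and has no zero on a circle `‖z - z₀‖ = ε` with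
`‖z₀‖ + ε < ρ`, then `0 < wind (c ∘ circleLoop z₀ ε)`.
[cite: Wendl2020, App. B Thm B.20 and Cor B.21 (similarity principle)] -/
theorem similarity_wind_pos_C1 (c : ℂ → ℂ) (M ρ : ℝ) (hc : ContDiff ℝ 1 c)
    (hbound : ∀ η : ℂ, ‖η‖ ≤ ρ → ‖dbarAlong 1 c η‖ ≤ M * ‖c η‖)
    {z₀ : ℂ} {ε : ℝ} (hε : 0 < ε) (hz₀ε : ‖z₀‖ + ε < ρ) (h0 : c z₀ = 0)
    (hw0 : ∀ z : ℂ, ‖z - z₀‖ = ε → c z ≠ 0) :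
    0 < wind (fun t => c (circleLoop z₀ ε t)) := by
  obtain ⟨ρ', hρ'₁, hρ'₂⟩ : ∃ ρ' : ℝ, ‖z₀‖ + ε < ρ' ∧ ρ' < ρ :=
    ⟨(‖z₀‖ + ε + ρ) / 2, by linarith, by linarith⟩
  have hρ'0 : 0 < ρ' := by linarith [norm_nonneg z₀]
  obtain ⟨S, H, hH, hcomp, hwind⟩ := similarity_comparison_C1 c M ρ ρ' hρ'0 hρ'₂ hc hbound
  rw [hwind z₀ ε hε hρ'₁ hw0]
  have hH0 : H z₀ = 0 := by
    have := (hcomp z₀ (by linarith)).2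
    rw [h0, norm_zero, mul_zero] at this
    exact norm_le_zero_iff.1 this
  have hHne : ∀ u : ℂ, ‖u - z₀‖ = ε → H u ≠ 0 := fun u hu hHu => by
    have huρ : ‖u‖ < ρ' := by
      have := norm_le_insert' u z₀
      linarith
    have h2 := (hcomp u huρ).1
    rw [hHu, norm_zero] at h2
    have h3 : 0 < Real.exp (-S) * ‖c u‖ := mul_pos (Real.exp_pos _) (norm_pos_iff.2 (hw0 u hu))
    linarith
  have hHball : DifferentiableOn ℂ H (ball z₀ (ρ' - ‖z₀‖)) :=
    hH.mono fun u hu => by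
      rw [mem_ball, dist_eq_norm] at hu
      rw [mem_ball_zero_iff]
      have := norm_le_insert' u z₀
      linarith
  exact wind_circleLoop_pos_of_zero_of_center H hε (by linarith) hHball (η₀ := z₀)
    (by simpa using hε) hH0 hHne

/-- **Similarity principle for `C¹` functions: non-negativity of the index** along any zero-free
circle `‖z - z₀‖ = ε` with `‖z₀‖ + ε < ρ`.
[cite: Wendl2020, App. B Thm B.20 and Cor B.21 (similarity principle)] -/
theorem similarity_wind_nonneg_C1 (c : ℂ → ℂ) (M ρ : ℝ) (hc : ContDiff ℝ 1 c)
    (hbound : ∀ η : ℂ, ‖η‖ ≤ ρ → ‖dbarAlong 1 c η‖ ≤ M * ‖c η‖)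
    {z₀ : ℂ} {ε : ℝ} (hε : 0 < ε) (hz₀ε : ‖z₀‖ + ε < ρ)
    (hw0 : ∀ z : ℂ, ‖z - z₀‖ = ε → c z ≠ 0) :
    0 ≤ wind (fun t => c (circleLoop z₀ ε t)) := by
  obtain ⟨ρ', hρ'₁, hρ'₂⟩ : ∃ ρ' : ℝ, ‖z₀‖ + ε < ρ' ∧ ρ' < ρ :=
    ⟨(‖z₀‖ + ε + ρ) / 2, by linarith, by linarith⟩
  have hρ'0 : 0 < ρ' := by linarith [norm_nonneg z₀]
  obtain ⟨S, H, hH, hcomp, hwind⟩ := similarity_comparison_C1 c M ρ ρ' hρ'0 hρ'₂ hc hbound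
  rw [hwind z₀ ε hε hρ'₁ hw0]
  have hHne : ∀ u : ℂ, ‖u - z₀‖ = ε → H u ≠ 0 := fun u hu hHu => by
    have huρ : ‖u‖ < ρ' := by
      have := norm_le_insert' u z₀
      linarith
    have h2 := (hcomp u huρ).1
    rw [hHu, norm_zero] at h2
    have h3 : 0 < Real.exp (-S) * ‖c u‖ := mul_pos (Real.exp_pos _) (norm_pos_iff.2 (hw0 u hu))
    linarith
  have key : ∀ t, circleLoop 0 ε t + z₀ = circleLoop z₀ ε t := fun t => by
    rw [circleLoop_apply, circleLoop_apply]
    ring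
  have hH₀ : DifferentiableOn ℂ (fun z => H (z + z₀)) (ball 0 (ρ' - ‖z₀‖)) :=
    hH.comp (differentiableOn_id.add_const z₀) fun z hz => by
      rw [mem_ball_zero_iff] at hz ⊢
      calc ‖z + z₀‖ ≤ ‖z‖ + ‖z₀‖ := norm_add_le _ _
        _ < ρ' := by linarith
  have h := wind_circleLoop_nonneg (fun z => H (z + z₀)) hε (by linarith) hH₀
    (fun u hu => hHne (u + z₀) (by simpa using hu))
  simpa only [key] using h

/-- **Similarity principle for `C¹` functions: isolated zeros of positive index.** If `c ∈ C¹`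
with `‖∂̄ c‖ ≤ M ‖c‖` on `‖z‖ ≤ ρ` vanishes at an interior point `z₀` but not identically on the
open disc, there is a small zero-free punctured closed disc `0 < ‖z - z₀‖ ≤ ε` about `z₀`
(`‖z₀‖ + ε < ρ`), and the winding number of `c` along its boundary circle is `> 0`.
[cite: Wendl2020, App. B Thm B.20 and Cor B.21 (similarity principle)] -/
theorem similarity_isolated_zero_C1 (c : ℂ → ℂ) (M ρ : ℝ) (hc : ContDiff ℝ 1 c)
    (hbound : ∀ η : ℂ, ‖η‖ ≤ ρ → ‖dbarAlong 1 c η‖ ≤ M * ‖c η‖)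
    (z₀ : ℂ) (hz₀ : ‖z₀‖ < ρ) (h0 : c z₀ = 0) (hne : ∃ z : ℂ, ‖z‖ < ρ ∧ c z ≠ 0) :
    ∃ ε : ℝ, 0 < ε ∧ ‖z₀‖ + ε < ρ ∧
      (∀ z : ℂ, 0 < ‖z - z₀‖ → ‖z - z₀‖ ≤ ε → c z ≠ 0) ∧
      0 < wind (fun t => c (circleLoop z₀ ε t)) := by
  obtain ⟨z₁, hz₁, h1⟩ := hne
  obtain ⟨ρ', hz₀', hz₁', hρ'⟩ : ∃ ρ' : ℝ, ‖z₀‖ < ρ' ∧ ‖z₁‖ < ρ' ∧ ρ' < ρ :=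
    ⟨(max ‖z₀‖ ‖z₁‖ + ρ) / 2, by have := le_max_left ‖z₀‖ ‖z₁‖; linarith [max_lt hz₀ hz₁],
      by have := le_max_right ‖z₀‖ ‖z₁‖; linarith [max_lt hz₀ hz₁], by linarith [max_lt hz₀ hz₁]⟩
  have hρ'0 : 0 < ρ' := (norm_nonneg _).trans_lt hz₀'
  obtain ⟨S, H, hH, hcomp, -⟩ := similarity_comparison_C1 c M ρ ρ' hρ'0 hρ' hc hbound
  have hH1 : H z₁ ≠ 0 := fun h => by
    have h2 := (hcomp z₁ hz₁').1
    rw [h, norm_zero] at h2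
    have h3 : 0 < Real.exp (-S) * ‖c z₁‖ := mul_pos (Real.exp_pos _) (norm_pos_iff.2 h1)
    linarith
  obtain ⟨ε, hε, hε', hHne⟩ := exists_radius hH hz₀' hz₁' hH1
  have hwne : ∀ z : ℂ, 0 < ‖z - z₀‖ → ‖z - z₀‖ ≤ ε → c z ≠ 0 := fun z hz1 hz2 hwz => by
    have hz : ‖z‖ < ρ' := by
      have := norm_le_insert' z z₀
      linarith
    have h2 := (hcomp z hz).2
    rw [hwz, norm_zero, mul_zero] at h2
    exact hHne z hz1 hz2 (norm_le_zero_iff.1 h2)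
  refine ⟨ε, hε, by linarith, hwne, ?_⟩
  exact similarity_wind_pos_C1 c M ρ hc hbound hε (by linarith) h0 fun z hz =>
    hwne z (by rw [hz]; exact hε) hz.le

/-! ### Consequences: the index bounds the vanishing order from above -/

/-- **Argument principle with a size bound: the index is at least the vanishing order.** If `H`
is holomorphic on `‖z‖ < ρ`, zero-free on the circle `‖z‖ = r` (`0 < r < ρ`), and
`‖H z‖ ≤ K ‖z‖ ^ m` on the disc, then `m ≤ wind (H ∘ circleLoop 0 r)`: `H = z^m G` with `G`
holomorphic (removable singularity of `H / z^m`, which is bounded by `K`), and `G` has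
non-negative index. [cite: Conway1978, Ch. V Thm 3.4 (argument principle)] -/
theorem wind_circleLoop_ge_of_norm_le_pow (H : ℂ → ℂ) {ρ r K : ℝ} {m : ℕ} (hr : 0 < r)
    (hrρ : r < ρ) (hH : DifferentiableOn ℂ H (ball 0 ρ)) (hsph : ∀ u : ℂ, ‖u‖ = r → H u ≠ 0)
    (hK : ∀ z ∈ ball (0 : ℂ) ρ, ‖H z‖ ≤ K * ‖z‖ ^ m) :
    (m : ℤ) ≤ wind (fun t => H (circleLoop 0 r t)) := by
  -- `G₀ = H / z^m` on the punctured disc, bounded by `K`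
  set G₀ : ℂ → ℂ := fun z => H z / z ^ m with hG₀_def
  have hG₀d : DifferentiableOn ℂ G₀ (ball 0 ρ \ {0}) :=
    (hH.mono Set.sdiff_subset).div (differentiableOn_id.pow m) fun z hz =>
      pow_ne_zero _ fun h => hz.2 h
  have hbdd : BddAbove (norm ∘ G₀ '' (ball 0 ρ \ {0})) := by
    refine ⟨K, ?_⟩
    rintro _ ⟨z, hz, rfl⟩
    have hz0 : z ≠ 0 := fun h => hz.2 h
    have hpos : 0 < ‖z‖ ^ m := pow_pos (norm_pos_iff.2 hz0) m
    show ‖H z / z ^ m‖ ≤ K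
    rw [norm_div, norm_pow, div_le_iff₀ hpos]
    exact hK z hz.1
  -- the holomorphic extension `G` over `0`
  set G : ℂ → ℂ := Function.update G₀ 0 (limUnder (𝓝[≠] (0 : ℂ)) G₀) with hG_def
  have hG : DifferentiableOn ℂ G (ball 0 ρ) :=
    Complex.differentiableOn_update_limUnder_of_bddAbove (ball_mem_nhds 0 (hr.trans hrρ)) hG₀d
      hbdd
  have hHG : ∀ z : ℂ, z ≠ 0 → H z = z ^ m * G z := by
    intro z hz0
    rw [hG_def, Function.update_of_ne hz0]
    show H z = z ^ m * (H z / z ^ m)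
    field_simp [pow_ne_zero m hz0]
  -- along the circle
  have hγ0 : ∀ t, circleLoop 0 r t ≠ 0 := fun t h0 => by
    have h := norm_circleLoop_sub_center 0 r t
    rw [sub_zero, h0, norm_zero, abs_of_pos hr] at h
    exact hr.ne' h.symm
  rw [wind_congr (g := fun t => circleLoop 0 r t ^ m * G (circleLoop 0 r t))
    (fun t _ => hHG _ (hγ0 t))]
  have hGne : ∀ u : ℂ, ‖u‖ = r → G u ≠ 0 := fun u hu hGu => by
    have hu0 : u ≠ 0 := fun h => by
      rw [h, norm_zero] at hu
      exact hr.ne' hu.symm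
    have h := hHG u hu0
    rw [hGu, mul_zero] at h
    exact hsph u hu h
  have hl1 : IsNonvanishingLoop (fun t => circleLoop 0 r t ^ m) :=
    ⟨((continuous_circleLoop 0 r).pow m).continuousOn, fun t _ => pow_ne_zero _ (hγ0 t),
      by rw [circleLoop_zero_eq]⟩
  have hγball : ∀ t, circleLoop 0 r t ∈ ball (0 : ℂ) ρ := fun t => by
    have h := norm_circleLoop_sub_center 0 r t
    rw [sub_zero, abs_of_pos hr] at h
    rw [mem_ball_zero_iff, h]
    exact hrρ
  have hl2 : IsNonvanishingLoop (fun t => G (circleLoop 0 r t)) := by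
    refine ⟨?_, fun t _ => hGne _ ?_, by rw [circleLoop_zero_eq]⟩
    · exact hG.continuousOn.comp (continuous_circleLoop 0 r).continuousOn fun t _ => hγball t
    · have h := norm_circleLoop_sub_center 0 r t
      rwa [sub_zero, abs_of_pos hr] at h
  -- the power loop winds `m` times
  have hpow : wind (fun t => circleLoop 0 r t ^ m) = m := by
    have hl : IsNonvanishingLoop (circleLoop 0 r) :=
      isNonvanishingLoop_circleLoop (by simp [abs_of_pos hr, hr.ne])
    have h := wind_zpow hl (m : ℤ)
    simp only [zpow_natCast] at h
    rw [h, wind_circleLoop_zero hr, mul_one]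
  rw [wind_mul hl1 hl2, hpow]
  have h := wind_circleLoop_nonneg G hr hrρ hG hGne
  linarith

/-- **Similarity principle for `C¹` functions: the index is at least the vanishing order.** If
`c ∈ C¹` with `‖∂̄ c‖ ≤ M ‖c‖` on `‖z‖ ≤ ρ` satisfies `‖c z‖ ≤ K ‖z‖ ^ m` on the disc and has no
zero on the circle `‖z‖ = ε` (`0 < ε < ρ`), then `m ≤ wind (c ∘ circleLoop 0 ε)` (the
holomorphic comparison function is `O(|z|^m)` as well).
[cite: Wendl2020, App. B Thm B.20 and Cor B.21 (similarity principle)] -/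
theorem similarity_wind_ge_of_norm_le_pow_C1 (c : ℂ → ℂ) (M ρ K : ℝ) (m : ℕ)
    (hc : ContDiff ℝ 1 c)
    (hbound : ∀ η : ℂ, ‖η‖ ≤ ρ → ‖dbarAlong 1 c η‖ ≤ M * ‖c η‖)
    (hK : ∀ z : ℂ, ‖z‖ ≤ ρ → ‖c z‖ ≤ K * ‖z‖ ^ m)
    {ε : ℝ} (hε : 0 < ε) (hερ : ε < ρ) (hw0 : ∀ z : ℂ, ‖z‖ = ε → c z ≠ 0) :
    (m : ℤ) ≤ wind (fun t => c (circleLoop 0 ε t)) := by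
  obtain ⟨ρ', hρ'₁, hρ'₂⟩ : ∃ ρ' : ℝ, ε < ρ' ∧ ρ' < ρ := ⟨(ε + ρ) / 2, by linarith, by linarith⟩
  have hρ'0 : 0 < ρ' := hε.trans hρ'₁
  obtain ⟨S, H, hH, hcomp, hwind⟩ := similarity_comparison_C1 c M ρ ρ' hρ'0 hρ'₂ hc hbound
  have hw0' : ∀ z : ℂ, ‖z - 0‖ = ε → c z ≠ 0 := fun z hz => hw0 z (by simpa using hz)
  rw [hwind 0 ε hε (by simpa using hρ'₁) hw0']
  have hK0 : 0 ≤ K := by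
    obtain ⟨u, hu⟩ : ∃ u : ℂ, ‖u‖ = ε := ⟨ε, by simp [hε.le]⟩
    have h1 := hK u (by linarith)
    have h2 : 0 < ‖c u‖ := norm_pos_iff.2 (hw0 u hu)
    have h3 : 0 < ‖u‖ ^ m := pow_pos (by rw [hu]; exact hε) m
    nlinarith
  have hHne : ∀ u : ℂ, ‖u‖ = ε → H u ≠ 0 := fun u hu hHu => by
    have h2 := (hcomp u (by linarith)).1
    rw [hHu, norm_zero] at h2
    have h3 : 0 < Real.exp (-S) * ‖c u‖ := mul_pos (Real.exp_pos _) (norm_pos_iff.2 (hw0 u hu))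
    linarith
  refine wind_circleLoop_ge_of_norm_le_pow H hε hρ'₁ hH hHne (K := Real.exp S * K) fun z hz => ?_
  have hz' : ‖z‖ < ρ' := mem_ball_zero_iff.1 hz
  calc ‖H z‖ ≤ Real.exp S * ‖c z‖ := (hcomp z hz').2
    _ ≤ Real.exp S * (K * ‖z‖ ^ m) :=
        mul_le_mul_of_nonneg_left (hK z (by linarith)) (Real.exp_pos S).le
    _ = Real.exp S * K * ‖z‖ ^ m := by ring

end Literature.Analysis.Complex

end
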